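import Summits.Langlands.Statement
import Literature.StrongHypotheses.Langlands
import HarnessLib
import HarnessLib.Audit.TribunalTags

/-!
# Summit `Langlands` — bridges of the Strong-Hypothesis Library (D-0034, skeleton)

Summit-side BRIDGE file for the registry `Literature/StrongHypotheses/Langlands.lean`: for every `H` tagged
there with `@[strong_hypothesis "Langlands.Langlands"]`, exactly ONE bridge tagged
`@[summit_bridge "Langlands.Langlands"]` concluding the ROOT problem decl `_root_.Langlands`
(`Summits/Langlands/Langlands/Statement.lean`: global Langlands reciprocity for `GL_n` over number fields,
both directions, all finite places, `∀` pinned reciprocity data).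

SKELETON (2026-08-17): the registry is EMPTY (census in the Literature file: every printed statement
strictly stronger than the summit — Buzzard–Gee reciprocity for general `G`, the automorphic Langlands group,
Clozel's motivic reciprocity — needs vocabulary the tree lacks; every conjecture `def` the tree has in the
Langlands neighbourhood is weaker than, incomparable with, or a parametrised predicate relative to the
summit), so there are

* LANDED bridges: 0;
* PRINTED bridges: 0;
* summit-side conjecture defs tagged here: 0 (the closed `Prop`s under `Summits/Langlands/Langlands/
  {Cruxes,Theorems}` named `…Hypothesis` / `…Criterion` — `LimitHypothesis`, `TwistedPolarizedLimitHypothesis`,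
  `NumericalCriterionDVR`, … — are route-internal inputs or route criteria, not summit-strength hypotheses;
  `Theses` decls are never tagged).

The file exists so that the Literature/summit pair is uniform and so that a later full D-0034 worker can
add the C-algebraic (Clozel) normalisation `LanglandsCAlgebraic ↔ _root_.Langlands` as a LANDED equivalent
criterion (census row 4). No new mathematics; no `sorry`, no axiom.
-/

namespace Summit.Langlands.StrongHypotheses

/-! ## Bridges: none at skeleton stage. -/

end Summit.Langlands.StrongHypotheses
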